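import Mathlib
import Literature.Probability.LatticeModels.ScalingLimit
import Literature.Probability.LatticeModels.FarFieldExpansion
import HarnessLib

/-!
# Far-field coefficients of a locally uniform expansion are continuous off the diagonals

Stub `stub_farFieldCoeffContinuous` of line `multipole-ward-nonsat-endpoint`
(crux `MoebiusLimitOfTwoPointLaw`, thesis PrecisionLaplacian of `Ising3DConformalLimit`).

If every `S m` is continuous on `NonCoincident 3 m` and `S (n+2)` admits the first-order
far-field expansion with monopole `A₀` and dipole `A₁` as its last point recedes to infinity,
locally uniformly on `NonCoincident 3 (n+1)`, then `A₀` and `A₁` are continuous on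
`NonCoincident 3 (n+1)`.  The expansion hypothesis is verbatim the predicate
`HasFarFieldExpansion S Δ (n+1) A₀ A₁` of
`Literature.Probability.LatticeModels.FarFieldExpansion`, and the two conclusions are its
`HasFarFieldExpansion.continuousOn_monopole` (symmetric average along `y = ± t u`) and
`HasFarFieldExpansion.continuousOn_dipole` (antipodal difference along `y = ± t e_k`), both via
`TendstoLocallyUniformlyOn.continuousOn`.
-/

namespace Summit.CriticalPhenomena.Ising3DConformalLimit.PrecisionLaplacianMoebiusLimitOfTwoPointLaw

open Literature.Probability.LatticeModels Filter Topology

/-- The locally uniform first-order far-field expansion of `S (n+2)` in its last point, as it is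
inlined in the line `multipole-ward-nonsat-endpoint`, is the predicate
`HasFarFieldExpansion S Δ (n+1) A₀ A₁`. -/
theorem ffc_hasFarFieldExpansion_iff (S : CorrFamily 3) (Δ : ℝ) (n : ℕ)
    (A₀ : (Fin (n + 1) → EuclideanSpace ℝ (Fin 3)) → ℝ)
    (A₁ : (Fin (n + 1) → EuclideanSpace ℝ (Fin 3)) → EuclideanSpace ℝ (Fin 3)) :
    HasFarFieldExpansion S Δ (n + 1) A₀ A₁ ↔
      TendstoLocallyUniformlyOn
        (fun (y : EuclideanSpace ℝ (Fin 3)) (w : Fin (n + 1) → EuclideanSpace ℝ (Fin 3)) =>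
          ‖y‖ ^ (2 * Δ + 1) * S (n + 2) (Fin.snoc w y) - ‖y‖ * A₀ w - inner ℝ (A₁ w) (‖y‖⁻¹ • y))
        0 (Filter.cocompact (EuclideanSpace ℝ (Fin 3))) (NonCoincident 3 (n + 1)) :=
  Iff.rfl

/-- **Far-field coefficients are continuous off the diagonals.** If all `S m` are continuous on
the non-coincident configurations and
`‖y‖^{2Δ+1} S_{n+2}(w, y) - ‖y‖ A₀ w - ⟪A₁ w, y/‖y‖⟫ → 0` as `y → ∞`, locally uniformly in
`w ∈ NonCoincident 3 (n+1)`, then the monopole `A₀` and the dipole `A₁` are continuous on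
`NonCoincident 3 (n+1)` (they are locally uniform limits of continuous symmetric averages,
resp. antipodal differences, of slices of `S (n+2)`). -/
theorem stub_farFieldCoeffContinuous :
    ∀ (S : CorrFamily 3) (Δ : ℝ) (n : ℕ) (A₀ : (Fin (n + 1) → EuclideanSpace ℝ (Fin 3)) → ℝ)
      (A₁ : (Fin (n + 1) → EuclideanSpace ℝ (Fin 3)) → EuclideanSpace ℝ (Fin 3)),
      (∀ m, ContinuousOn (S m) (NonCoincident 3 m)) →
      TendstoLocallyUniformlyOn
        (fun (y : EuclideanSpace ℝ (Fin 3)) (w : Fin (n + 1) → EuclideanSpace ℝ (Fin 3)) =>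
          ‖y‖ ^ (2 * Δ + 1) * S (n + 2) (Fin.snoc w y) - ‖y‖ * A₀ w - inner ℝ (A₁ w) (‖y‖⁻¹ • y))
        0 (Filter.cocompact (EuclideanSpace ℝ (Fin 3))) (NonCoincident 3 (n + 1)) →
      ContinuousOn A₀ (NonCoincident 3 (n + 1)) ∧ ContinuousOn A₁ (NonCoincident 3 (n + 1)) := by
  intro S Δ n A₀ A₁ hcont hE
  have h : HasFarFieldExpansion S Δ (n + 1) A₀ A₁ := (ffc_hasFarFieldExpansion_iff S Δ n A₀ A₁).2 hE
  exact ⟨h.continuousOn_monopole (hcont (n + 1 + 1)), h.continuousOn_dipole (hcont (n + 1 + 1))⟩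

end Summit.CriticalPhenomena.Ising3DConformalLimit.PrecisionLaplacianMoebiusLimitOfTwoPointLaw
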